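import Summits.BirchSwinnertonDyer.Rank1Residual.X12.CMRamifiedRecordSchemaC
import HarnessLib

/-!
# Leaf `CornerF ∧ p ramified in K` (K12r): certificate-record schema, PART E — the REGIME letter
# `N / T / V` of a K12r@3 class (planner PLAN.md v2 §2 «ty3: add field regime ∈ {N,T,V} + c_split3»;
# cell `bsd-print-cfram`, typer seat `ty3`; addendum to `X12/CMRamifiedRecordSchemaC.lean`)

HONEST FRAMING (cell `bsd-print-cfram`, run/shared/lean/pub/bsd-print-cfram/, verbatim in every file
of the cell): PARTITION currency only — the leaf counts when its class theorem is in the kernel BY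
NAME, flag-free; Literature named facts are statement-only with cite tags, never sorried theorems;
every imported theorem carries its printed hypotheses verbatim; numbers, not adjectives. THIS FILE IS
DATA INFRASTRUCTURE (a computable record, a decidable recheck); nothing about any elliptic curve is
asserted, no named fact is introduced, nothing is booked, no mark moves (the leaf K12r and its `p = 3`
slice `Summit.BirchSwinnertonDyer.WAllCornerFRamifiedAtThree` stay OPEN; the regime children N / T / V
of crux C1 — route `PrintCFram` rev 6, items stmt-BirchSwinnertonDyer-20698 / -20699 / -20700 — stay OPEN).

## The three regimes of the `p = 3` slice (PLAN.md v2 §1/§1a) and how a record decides them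

For a K12r@3 class with `j = 0` edge `W = E_k — W' = E_{−27k} ≅ W^{(−3)}`:
* **T** (`LocalThreeTorsionBSDThree`, -20699): `W(ℚ₃)` or `W'(ℚ₃)` has a non-zero `3`-torsion point —
  PART C's closed form `hasLocal3Tors k ∨ hasLocal3Tors (−27k)` (`ψ₃ = 3x(x³ + 4k)`; the form is
  invariant under `k ↦ k·u⁶`, so `−27k` may stand for the sixth-power-free `k'`); by p4's kernel
  criterion `X12.JZeroThree.noThreeTorsion_pair_iff_of_mordell_model` (p546152) this is
  `¬((a even ∧ m ≡ 2) ∨ (a odd ∧ m ≡ 1) (mod 3))` for `k = 3ᵃm`, i.e. Kriz–Li's (1) fails (`d* ≢ 2 (3)`);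
* **V** (`SplitPlaceTorsionBSDThree`, -20700): not T, but `3 ∣ c_ℓ(W)` at some bad `ℓ ≡ 1 (mod 3)`
  (a degree-one place of `K = ℚ(√−3)` with `K_v`-rational `3`-torsion) — PART C's `awayOK` false;
* **N** (`TorsionFreeFrameBSDThree`, -20698): neither — the O11@3 frame binders `htors ∧ htors' ∧ hv`
  hold (PART C's `subLeaf`).
`regimeCode k tam ∈ {0 = N, 1 = T, 2 = V}` computes the letter from `k` and the recorded Tamagawa list
of `W`; `cSplit3Of tam = v₃(∏_{ℓ ≡ 1 (3)} c_ℓ(W))` is the planner's `c_split3`. A `RegimeRow` carries, per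
class, `k`, the Tamagawa list (two engines, PART C), the letter, `cSplit3`, PART C's `subLeaf`, PART D's
3-unit-regime `eligible` bit (`unitRegime`) and PART B's print-booking `status`; `RegimeRow.consistent`
rechecks the letter and `cSplit3` against `k`/`tam`, `subLeaf ↔ regime = N`, and `unitRegime → regime
= N` (p3's 27 eligible classes lie in N — REF cross-census 15:27:36Z).

References: PLAN.md v2 §1–§2; `X12/CMRamifiedRecordSchemaC.lean` (`hasLocal3Tors`, `awayOK`);
`X12/JZeroThreeTorsionCriterion.lean` (p4); `X12/CMRamifiedRecordSchemaD.lean` (PART D); REFEREE.md S7/S16.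
-/

set_option autoImplicit false

namespace Summit.BirchSwinnertonDyer.Rank1Residual.X12.CMRamifiedRecords

open Summit.BirchSwinnertonDyer.BirchSwinnertonDyer.Rank1Residual.HeegnerIndexRecords

/-- The regime letter of a K12r@3 class from `k` (curve 1 `= E_k`) and the Tamagawa list of `W`:
`1 = T` if `E_k(ℚ₃)` or `E_{−27k}(ℚ₃)` has non-zero `3`-torsion, else `2 = V` if `3 ∣ c_ℓ(W)` at some
bad `ℓ ≡ 1 (mod 3)`, else `0 = N`. [folklore] -/
def regimeCode (k : ℤ) (tam : List (ℕ × ℕ)) : ℕ :=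
  if hasLocal3Tors k || hasLocal3Tors (-27 * k) then 1 else if awayOK tam then 0 else 2

/-- `c_split3 = v₃(∏_{ℓ ≡ 1 (mod 3)} c_ℓ(W))` on a recorded Tamagawa list. [folklore] -/
def cSplit3Of (tam : List (ℕ × ℕ)) : ℕ :=
  vp 3 (tam.foldl (fun acc lc => if lc.1 % 3 == 1 then acc * lc.2 else acc) 1 : ℕ)

/-- **REGIME record of a K12r@3 class** (module docstring): `k` of curve 1, the Tamagawa list of `W`,
the letter `regime ∈ {0 = N, 1 = T, 2 = V}`, `cSplit3`, PART C's `subLeaf`, PART D's `unitRegime`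
(3-unit-regime eligible), PART B's `status` (booked by a printed family). [folklore] -/
structure RegimeRow where
  label : String
  cls : String
  k : ℤ
  tam : List (ℕ × ℕ)
  regime : ℕ
  cSplit3 : ℕ
  subLeaf : Bool
  unitRegime : Bool
  status : ℕ

/-- The in-kernel recheck of a `RegimeRow`: the letter and `cSplit3` recomputed, `subLeaf ↔ regime = N`,
`unitRegime → regime = N`, `status ∈ {0,1}`. [folklore] -/
def RegimeRow.consistent (r : RegimeRow) : Bool :=
  (r.k != 0) && (r.regime == regimeCode r.k r.tam) && (r.cSplit3 == cSplit3Of r.tam) &&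
  (r.subLeaf == (r.regime == 0)) && (!r.unitRegime || r.regime == 0) && (r.status == 0 || r.status == 1)

/-- A consistent record's letter is the recomputed one, and a 3-unit-regime class is in regime N. [folklore] -/
theorem RegimeRow.regime_eq_of_consistent {r : RegimeRow} (h : r.consistent = true) :
    r.regime = regimeCode r.k r.tam ∧ (r.unitRegime = true → r.regime = 0) := by
  simp only [RegimeRow.consistent, Bool.and_eq_true, Bool.or_eq_true, Bool.not_eq_true', beq_iff_eq]
    at h
  obtain ⟨⟨⟨⟨⟨-, h1⟩, -⟩, -⟩, h2⟩, -⟩ := h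
  refine ⟨h1, fun hu => ?_⟩
  rcases h2 with h2 | h2
  · rw [hu] at h2; exact absurd h2 (by decide)
  · exact h2

/-- Unpacking a display theorem `rs.all RegimeRow.consistent = true` per member. [folklore] -/
theorem RegimeRow.consistent_of_all {rs : List RegimeRow} (h : rs.all RegimeRow.consistent = true)
    {r : RegimeRow} (hr : r ∈ rs) : r.consistent = true :=
  List.all_eq_true.1 h r hr

end Summit.BirchSwinnertonDyer.Rank1Residual.X12.CMRamifiedRecords
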